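import Mathlib
import Literature.Probability.LatticeModels.ThermodynamicLimit
import Literature.MathematicalPhysics.QuantumLattice.LatticeScalarField

/-!
# Route `UniversalDetector`, support item `LimitExtraction` (stmt-QuantumFields-26597): uniform lattice Riemann bounds

Ideator seat ym-idea-8 g4.  The Riemann-sum half of `LimitExtraction` (convergence of
`Q2 = Σ_{x,y ∈ box 4 L} w₁(a x) w₂(a y) Cov(A_x, A_y) = a⁸ Σ w₁(a x) w₂(a y) ker(y - x)` to
`∫∫ w₁(x) w₂(y) K(y - x)`) runs on dominated convergence over the lattices `a ℤ⁴ ∩ [-aL, aL]⁴`, `a → 0`,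
`aL → ∞`; the constants it needs are bounds UNIFORM in the spacing and the box:

* `latticeRiemannBound` — `s^d · Σ_{x ∈ box d L} (1 + ‖s x‖)^{-2d} ≤ 4^d` for `0 < s ≤ 1` (product comparison
  `(1 + ‖u‖)^{2d} ≥ Π_i (1 + |u_i|)²`, `Finset.sum_prod_piFinset`, and the telescoping one-dimensional bound
  `s Σ_{n ∈ [-L,L]} (1 + s|n|)^{-2} ≤ 4`);
* `schwartz_latticeRiemannBound` — `s^d Σ_{x ∈ box d L} |w(s x)| ≤ B_w` for a Schwartz `w`;
* `schwartz_latticeRiemannTail` — the part with `‖s x‖ ≥ R` is `≤ B'_w / (1 + R)`.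

(The pair weights `|w₁(s x)| |w₂(s y)|` of `Q2` are products of these.)  Mathlib + the tree's `box` / `siteToE`
only; no lattice gauge theory enters; no summit, leg or spine statement is proved here.
-/

set_option autoImplicit false

namespace Summit.QuantumFields.YangMills.Cruxes.UniversalDetectorLimitExtraction

open Finset Literature.Probability.LatticeModels Literature.MathematicalPhysics.QuantumLattice

/-! ### Part A: the one-dimensional telescoping bound -/

/-- Telescoping: `s · Σ_{m<L} 1/(1+s(m+1))² ≤ 1` for `s > 0`. -/
private lemma sum_range_inv_sq_le {s : ℝ} (hs : 0 < s) (L : ℕ) :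
    s * ∑ m ∈ range L, ((1 + s * ((m : ℝ) + 1)) ^ 2)⁻¹ ≤ 1 := by
  have hterm : ∀ m : ℕ, s * ((1 + s * ((m : ℝ) + 1)) ^ 2)⁻¹ ≤
      (1 + s * (m : ℝ))⁻¹ - (1 + s * ((m : ℝ) + 1))⁻¹ := by
    intro m
    have h1 : 0 < 1 + s * (m : ℝ) := by positivity
    have h2 : 0 < 1 + s * ((m : ℝ) + 1) := by positivity
    rw [inv_sub_inv h1.ne' h2.ne']
    have h3 : (1 + s * ((m : ℝ) + 1)) - (1 + s * (m : ℝ)) = s := by ring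
    rw [h3, div_eq_mul_inv]
    refine mul_le_mul_of_nonneg_left (inv_anti₀ (by positivity) (by nlinarith)) hs.le
  calc s * ∑ m ∈ range L, ((1 + s * ((m : ℝ) + 1)) ^ 2)⁻¹
      = ∑ m ∈ range L, s * ((1 + s * ((m : ℝ) + 1)) ^ 2)⁻¹ := by rw [mul_sum]
    _ ≤ ∑ m ∈ range L, ((1 + s * (m : ℝ))⁻¹ - (1 + s * ((m : ℝ) + 1))⁻¹) := sum_le_sum fun m _ => hterm m
    _ = 1 - (1 + s * (L : ℝ))⁻¹ := by
        have := sum_range_sub (fun m : ℕ => -(1 + s * (m : ℝ))⁻¹) L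
        simp only [Nat.cast_add, Nat.cast_one, neg_sub_neg, Nat.cast_zero, mul_zero, add_zero, inv_one] at this
        linarith [this]
    _ ≤ 1 := by
        have : 0 ≤ (1 + s * (L : ℝ))⁻¹ := by positivity
        linarith

/-- `Σ_{m ≤ L} 1/(1+sm)² ≤ 1 + 1/s` for `s > 0` (the `m = 0` term plus the telescoped tail). -/
private lemma sum_range_succ_inv_sq_le {s : ℝ} (hs : 0 < s) (L : ℕ) :
    ∑ m ∈ range (L + 1), ((1 + s * (m : ℝ)) ^ 2)⁻¹ ≤ 1 + s⁻¹ := by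
  rw [sum_range_succ']
  simp only [Nat.cast_add, Nat.cast_one, Nat.cast_zero, mul_zero, add_zero, one_pow, inv_one]
  have h := sum_range_inv_sq_le hs L
  have h' : ∑ m ∈ range L, ((1 + s * ((m : ℝ) + 1)) ^ 2)⁻¹ ≤ s⁻¹ := by
    rw [← one_div]; exact (le_div_iff₀' hs).mpr h
  linarith

/-- The symmetric one-dimensional sum: `s · Σ_{n ∈ [-L, L]} 1/(1+s|n|)² ≤ 4` for `0 < s ≤ 1`. -/
private lemma sum_Icc_inv_sq_le {s : ℝ} (hs : 0 < s) (hs1 : s ≤ 1) (L : ℕ) :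
    s * ∑ n ∈ Icc (-(L : ℤ)) L, ((1 + s * |(n : ℝ)|) ^ 2)⁻¹ ≤ 4 := by
  set h : ℤ → ℝ := fun n => ((1 + s * |(n : ℝ)|) ^ 2)⁻¹ with hh
  have hnn : ∀ n, 0 ≤ h n := fun n => by positivity
  -- cover `[-L, L]` by the images of `range (L+1)` under `m ↦ m` and `m ↦ -m`
  set A : Finset ℤ := (range (L + 1)).image (fun m : ℕ => (m : ℤ)) with hA
  set B : Finset ℤ := (range (L + 1)).image (fun m : ℕ => -(m : ℤ)) with hB
  have hcover : Icc (-(L : ℤ)) L ⊆ A ∪ B := by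
    intro n hn
    rw [mem_Icc] at hn
    rcases le_or_gt 0 n with h0 | h0
    · refine mem_union_left _ (mem_image.mpr ⟨n.toNat, mem_range.mpr (by omega), by omega⟩)
    · refine mem_union_right _ (mem_image.mpr ⟨(-n).toNat, mem_range.mpr (by omega), by omega⟩)
  have hAsum : ∑ n ∈ A, h n = ∑ m ∈ range (L + 1), ((1 + s * (m : ℝ)) ^ 2)⁻¹ := by
    rw [hA, sum_image (fun a _ b _ hab => by exact_mod_cast hab)]
    refine sum_congr rfl fun m _ => ?_
    simp [hh, Nat.abs_cast]
  have hBsum : ∑ n ∈ B, h n = ∑ m ∈ range (L + 1), ((1 + s * (m : ℝ)) ^ 2)⁻¹ := by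
    rw [hB, sum_image (fun a _ b _ hab => by exact_mod_cast neg_inj.mp hab)]
    refine sum_congr rfl fun m _ => ?_
    simp [hh, Nat.abs_cast]
  have hle : ∑ n ∈ Icc (-(L : ℤ)) L, h n ≤ ∑ n ∈ A, h n + ∑ n ∈ B, h n := by
    calc ∑ n ∈ Icc (-(L : ℤ)) L, h n ≤ ∑ n ∈ A ∪ B, h n := sum_le_sum_of_subset_of_nonneg hcover fun n _ _ => hnn n
      _ ≤ ∑ n ∈ A, h n + ∑ n ∈ B, h n := by
          rw [← sum_union_inter]
          have : 0 ≤ ∑ n ∈ A ∩ B, h n := sum_nonneg fun n _ => hnn n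
          linarith
  have h1 := sum_range_succ_inv_sq_le hs L
  calc s * ∑ n ∈ Icc (-(L : ℤ)) L, h n
      ≤ s * (∑ n ∈ A, h n + ∑ n ∈ B, h n) := by gcongr
    _ = 2 * (s * ∑ m ∈ range (L + 1), ((1 + s * (m : ℝ)) ^ 2)⁻¹) := by rw [hAsum, hBsum]; ring
    _ ≤ 2 * (s * (1 + s⁻¹)) := by gcongr
    _ = 2 * s + 2 := by rw [mul_add, mul_inv_cancel₀ hs.ne']; ring
    _ ≤ 4 := by linarith

/-! ### Part B: the lattice Riemann bound -/

/-- A coordinate is bounded by the Euclidean norm. -/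
private lemma abs_apply_le_norm {d : ℕ} (u : EuclideanSpace ℝ (Fin d)) (i : Fin d) : |u i| ≤ ‖u‖ := by
  rw [EuclideanSpace.norm_eq, ← Real.sqrt_sq_eq_abs]
  refine Real.sqrt_le_sqrt (Finset.single_le_sum (f := fun j => ‖u j‖ ^ 2) (fun j _ => by positivity)
    (Finset.mem_univ i) |>.trans_eq' ?_)
  simp [Real.norm_eq_abs]

/-- **Uniform lattice Riemann bound.**  For `0 < s ≤ 1` and every box,
`s^d · Σ_{x ∈ box d L} (1 + ‖s x‖)^{-2d} ≤ 4^d` — Riemann sums of the integrable weight `(1+‖u‖)^{-2d}`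
over `s ℤ^d ∩ [-sL, sL]^d` are bounded uniformly in the spacing and the box. -/
theorem latticeRiemannBound (d L : ℕ) {s : ℝ} (hs : 0 < s) (hs1 : s ≤ 1) :
    s ^ d * ∑ x ∈ box d L, ((1 + ‖s • siteToE x‖) ^ (2 * d))⁻¹ ≤ 4 ^ d := by
  -- compare with the product weight
  have hprod : ∀ x : Site d, ((1 + ‖s • siteToE x‖) ^ (2 * d))⁻¹ ≤
      ∏ i : Fin d, ((1 + s * |((x i : ℤ) : ℝ)|) ^ 2)⁻¹ := by
    intro x
    rw [Finset.prod_inv_distrib]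
    have h1 : ∏ i : Fin d, (1 + s * |((x i : ℤ) : ℝ)|) ^ 2 ≤ (1 + ‖s • siteToE x‖) ^ (2 * d) := by
      calc ∏ i : Fin d, (1 + s * |((x i : ℤ) : ℝ)|) ^ 2 ≤ ∏ _i : Fin d, (1 + ‖s • siteToE x‖) ^ 2 := by
            refine Finset.prod_le_prod (fun i _ => by positivity) fun i _ => ?_
            gcongr
            have := abs_apply_le_norm (s • siteToE x) i
            rwa [PiLp.smul_apply, siteToE_apply, smul_eq_mul, abs_mul, abs_of_pos hs] at this
        _ = (1 + ‖s • siteToE x‖) ^ (2 * d) := by rw [Finset.prod_const, Finset.card_univ, Fintype.card_fin, ← pow_mul, mul_comm]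
    exact inv_anti₀ (Finset.prod_pos fun i _ => by positivity) h1
  calc s ^ d * ∑ x ∈ box d L, ((1 + ‖s • siteToE x‖) ^ (2 * d))⁻¹
      ≤ s ^ d * ∑ x ∈ box d L, ∏ i : Fin d, ((1 + s * |((x i : ℤ) : ℝ)|) ^ 2)⁻¹ := by
        gcongr with x _; exact hprod x
    _ = s ^ d * ∏ _i : Fin d, ∑ n ∈ Icc (-(L : ℤ)) L, ((1 + s * |(n : ℝ)|) ^ 2)⁻¹ := by
        rw [Literature.Probability.LatticeModels.box]
        congr 1
        exact sum_prod_piFinset (Icc (-(L : ℤ)) L) (fun (_ : Fin d) (n : ℤ) => ((1 + s * |(n : ℝ)|) ^ 2)⁻¹)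
    _ = (s * ∑ n ∈ Icc (-(L : ℤ)) L, ((1 + s * |(n : ℝ)|) ^ 2)⁻¹) ^ d := by
        rw [Finset.prod_const, Finset.card_univ, Fintype.card_fin, mul_pow]
    _ ≤ 4 ^ d := by
        refine pow_le_pow_left₀ (by positivity) (sum_Icc_inv_sq_le hs hs1 L) d

/-! ### Part C: Schwartz corollaries -/

/-- Polynomial decay of a Schwartz function: `|w u| ≤ 2^k S_k / (1 + ‖u‖)^k`. -/
private lemma schwartz_decay {d : ℕ} (w : SchwartzMap (EuclideanSpace ℝ (Fin d)) ℝ) (k : ℕ) :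
    ∃ C : ℝ, 0 ≤ C ∧ ∀ u : EuclideanSpace ℝ (Fin d), |w u| ≤ C * ((1 + ‖u‖) ^ k)⁻¹ := by
  refine ⟨2 ^ k * (Finset.Iic (k, 0)).sup (fun m => SchwartzMap.seminorm ℝ m.1 m.2) w, by positivity,
    fun u => ?_⟩
  have h := SchwartzMap.one_add_le_sup_seminorm_apply (𝕜 := ℝ) (m := (k, 0)) le_rfl le_rfl w u
  rw [norm_iteratedFDeriv_zero, Real.norm_eq_abs] at h
  have hpos : 0 < (1 + ‖u‖) ^ k := by positivity
  rw [← div_eq_mul_inv, le_div_iff₀ hpos, mul_comm]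
  exact h

/-- **Uniform Riemann bound for a Schwartz weight**: `s^d Σ_{x ∈ box d L} |w(s x)| ≤ B_w` for all boxes and
all spacings `0 < s ≤ 1`. -/
theorem schwartz_latticeRiemannBound {d : ℕ} (w : SchwartzMap (EuclideanSpace ℝ (Fin d)) ℝ) :
    ∃ B : ℝ, 0 ≤ B ∧ ∀ (L : ℕ) (s : ℝ), 0 < s → s ≤ 1 →
      s ^ d * ∑ x ∈ box d L, |w (s • siteToE x)| ≤ B := by
  obtain ⟨C, hC, hw⟩ := schwartz_decay w (2 * d)
  refine ⟨C * 4 ^ d, by positivity, fun L s hs hs1 => ?_⟩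
  calc s ^ d * ∑ x ∈ box d L, |w (s • siteToE x)|
      ≤ s ^ d * ∑ x ∈ box d L, C * ((1 + ‖s • siteToE x‖) ^ (2 * d))⁻¹ := by
        gcongr with x _; exact hw _
    _ = C * (s ^ d * ∑ x ∈ box d L, ((1 + ‖s • siteToE x‖) ^ (2 * d))⁻¹) := by rw [← mul_sum]; ring
    _ ≤ C * 4 ^ d := by gcongr; exact latticeRiemannBound d L hs hs1

/-- **Uniform Riemann tail bound for a Schwartz weight**: the part of `s^d Σ_{x ∈ box d L} |w(s x)|` carried by
the lattice points with `‖s x‖ ≥ R` is `≤ B'_w / (1 + R)`, uniformly in the box and the spacing `0 < s ≤ 1`. -/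
theorem schwartz_latticeRiemannTail {d : ℕ} (w : SchwartzMap (EuclideanSpace ℝ (Fin d)) ℝ) :
    ∃ B : ℝ, 0 ≤ B ∧ ∀ (L : ℕ) (s R : ℝ), 0 < s → s ≤ 1 → 0 ≤ R →
      s ^ d * ∑ x ∈ (box d L).filter (fun x => R ≤ ‖s • siteToE x‖), |w (s • siteToE x)| ≤ B / (1 + R) := by
  obtain ⟨C, hC, hw⟩ := schwartz_decay w (2 * d + 1)
  refine ⟨C * 4 ^ d, by positivity, fun L s R hs hs1 hR => ?_⟩
  have hpt : ∀ x ∈ (box d L).filter (fun x => R ≤ ‖s • siteToE x‖),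
      |w (s • siteToE x)| ≤ C / (1 + R) * ((1 + ‖s • siteToE x‖) ^ (2 * d))⁻¹ := by
    intro x hx
    have hRx : R ≤ ‖s • siteToE x‖ := (mem_filter.mp hx).2
    refine (hw _).trans ?_
    rw [pow_succ, mul_inv, ← mul_assoc, div_eq_mul_inv, mul_assoc C, mul_comm ((1 + ‖s • siteToE x‖) ^ (2 * d))⁻¹,
      ← mul_assoc C]
    gcongr C * ?_ * _
    exact inv_anti₀ (by positivity) (by linarith)
  calc s ^ d * ∑ x ∈ (box d L).filter (fun x => R ≤ ‖s • siteToE x‖), |w (s • siteToE x)|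
      ≤ s ^ d * ∑ x ∈ (box d L).filter (fun x => R ≤ ‖s • siteToE x‖),
          C / (1 + R) * ((1 + ‖s • siteToE x‖) ^ (2 * d))⁻¹ := by
        gcongr with x hx; exact hpt x hx
    _ ≤ s ^ d * ∑ x ∈ box d L, C / (1 + R) * ((1 + ‖s • siteToE x‖) ^ (2 * d))⁻¹ :=
        mul_le_mul_of_nonneg_left
          (sum_le_sum_of_subset_of_nonneg (filter_subset _ _) fun x _ _ => by positivity) (by positivity)
    _ = C / (1 + R) * (s ^ d * ∑ x ∈ box d L, ((1 + ‖s • siteToE x‖) ^ (2 * d))⁻¹) := by rw [← mul_sum]; ring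
    _ ≤ C / (1 + R) * 4 ^ d := by gcongr; exact latticeRiemannBound d L hs hs1
    _ = C * 4 ^ d / (1 + R) := by ring

end Summit.QuantumFields.YangMills.Cruxes.UniversalDetectorLimitExtraction
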